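import Summits.QuantumFields.YangMills.Theorems.UnitScaleTiltProp7GaugeDirRotationDivergence
import Summits.QuantumFields.YangMills.Theorems.UnitScaleTiltProp7NestedMeanPoincare
import HarnessLib

/-!
# Route `UnitScaleTilt`, crux K1 child «MinimiserStabilityRegPr» (stmt-QuantumFields-19200), skeleton v10, stub `stub_existenceMinimalOrbit` (EX), route (α) —
# **(E1) IN THE WEIGHTED `L²` LETTERS OF BRICK L0a**: the pointwise bound ✓`Prop7GaugeDirRotationDivergence.norm_DstarPi_rot_le` summed over the torus —
# `‖D*_{U₀}(toL2 (rot N))‖ ≤ 2e^{εη}e^{εη}·ε·η·(6‖toL2S N‖ + 4‖D_{U₀}(toL2S N)‖)` in the `SiteL2K`∕`BondL2K` norms (weight `c₀` on both sides; Frobenius ↔ operator norm on `M₂(ℂ)`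
# through ★px20's dictionary ✓`Prop7NestedMeanPoincare.normSq_toL2S_eq`∕`normSq_toL2_eq`∕`normSq_toL2S_le_two_mul` and lit ✓`MatrixNorms.opNorm_sq_le_sum_norm_sq`) — the form
# in which the pairing margin (LOCATE memo `pub/ym3-torus/ym-ust-20520-w5/g7/LOCATE-P2-MARGIN-w5g7.md` §2 (M)) consumes (E1): `|⟪D*((X − D_{U₀})N), Δ^η l⟫| ≤ ‖D*(…)‖·‖Δ^η l‖`.

Cell `ym3-torus`, width seat `ym-ust-20520-w5` (gen 7).  THEOREMS ONLY (0 `def`, 0 `sorry`).  `--supports stmt-QuantumFields-19200 --as helper`, count-neutral.  YM₃ on T³ is a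
ladder rung (R3), not the Clay problem; nothing here claims the stub, the crux, d = 4 or the mass gap.

WHAT IS PROVED (sorry-free, no definition; ns `…Theorems.Prop7GaugeDirRotationDivergence`, same as the pointwise file):
* `sum_site_dir_eq_sum_bond` — `Σ_x Σ_μ g ⟨x, μ⟩ = Σ_b g b` (the bonds of the torus are the pairs (site, direction)); [folklore]
* `sq_three_mul_add_sum_le` — `(3a + Σ_μ g_μ)² ≤ 18a² + 6Σ_μ g_μ²` (Cauchy–Schwarz over the three directions); [folklore]
* `mul_sum_normSq_le_normSq_toL2S`, `mul_sum_normSq_le_normSq_DL2` — `c₀Σ_x‖N x‖²_op ≤ ‖toL2S N‖²`, `c₀Σ_b‖(D_{U₀}N)(b)‖²_op ≤ ‖DL2 U₀ (toL2S N)‖²` (operator ≤ Frobenius);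
* ★★`norm_DstarL2_rot_le` — the displayed `L²` bound.
HONEST SCOPE.  Bookkeeping over landed letters; constants crude (`6`, `4`); nothing of print is asserted; no stub ∕ crux statement is advanced.

References: T. Bałaban, CMP 99 (1985) 389–434 [Balaban1985BackgroundPropagators] ((3.3) p.391, (3.8) p.392, (3.11) p.392); CMP 102 (1985) 277–309 [Balaban1985Variational] ((19) p.281).
-/

set_option autoImplicit false

noncomputable section

open scoped Matrix.Norms.L2Operator BigOperators
open NormedSpace

namespace Summit.QuantumFields.YangMills.Theorems.Prop7GaugeDirRotationDivergence

open Literature.MathematicalPhysics.QuantumFieldTheory.Balaban1983to89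
open Literature.MathematicalPhysics.QuantumFieldTheory.Balaban1983to89.T3ContinuumYM3Torus
open Literature.MathematicalPhysics.QuantumFieldTheory.Balaban1983to89.T3SectALandauChart (eta eta_pos bgUnits covGradT)
open Summit.QuantumFields.YangMills.Theorems.Prop7SectET3HilbertLetters (W₂ toL2 toL2S DL2 DstarL2)
open Summit.QuantumFields.YangMills.Theorems.Prop7SectET3GaugeProjector (DstarPi DstarPi_apply)
open Summit.QuantumFields.YangMills.Theorems.Prop7NestedMeanPoincare (normSq_toL2S_eq normSq_toL2_eq normSq_toL2S_le_two_mul)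

variable (F : T3Family) {n K : ℕ} {c₀ : ℝ} [Fact (0 < c₀)]

/-! ## §1 Bookkeeping -/

/-- **THE BONDS ARE THE PAIRS (SITE, DIRECTION)**: `Σ_x Σ_μ g ⟨x, μ⟩ = Σ_b g b` on the finest torus of the member. [folklore] -/
theorem sum_site_dir_eq_sum_bond (g : PBond (F.P K) 0 → ℝ) :
    ∑ x : Site (F.P K) 0, ∑ μ : Fin 3, g ⟨x, μ⟩ = ∑ b : PBond (F.P K) 0, g b := by
  let e : Site (F.P K) 0 × Fin 3 ≃ PBond (F.P K) 0 :=
    ⟨fun p => ⟨p.1, p.2⟩, fun b => (b.src, b.dir), fun _ => rfl, fun _ => rfl⟩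
  calc ∑ x : Site (F.P K) 0, ∑ μ : Fin 3, g ⟨x, μ⟩ = ∑ p : Site (F.P K) 0 × Fin 3, g ⟨p.1, p.2⟩ :=
        (Fintype.sum_prod_type (fun p : Site (F.P K) 0 × Fin 3 => g ⟨p.1, p.2⟩)).symm
    _ = ∑ b : PBond (F.P K) 0, g b := Fintype.sum_equiv e _ _ fun _ => rfl

/-- `(3a + Σ_μ g_μ)² ≤ 18a² + 6Σ_μ g_μ²` over the three directions. [folklore] -/
theorem sq_three_mul_add_sum_le (a : ℝ) (g : Fin 3 → ℝ) :
    (3 * a + ∑ μ : Fin 3, g μ) ^ 2 ≤ 18 * a ^ 2 + 6 * ∑ μ : Fin 3, (g μ) ^ 2 := by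
  have hcs : (∑ μ : Fin 3, g μ) ^ 2 ≤ 3 * ∑ μ : Fin 3, (g μ) ^ 2 := by
    have h := sq_sum_le_card_mul_sum_sq (s := (Finset.univ : Finset (Fin 3))) (f := g)
    simpa [Finset.card_univ, Fintype.card_fin] using h
  nlinarith [sq_nonneg (3 * a - ∑ μ : Fin 3, g μ), hcs]

/-- `c₀·Σ_x‖N(x)‖²_op ≤ ‖toL2S N‖²` (operator norm ≤ Frobenius norm on `M₂(ℂ)`). [cite: Balaban1985BackgroundPropagators, (3.11) p.392] -/
theorem mul_sum_normSq_le_normSq_toL2S (N : Site (F.P K) 0 → Matrix (Fin 2) (Fin 2) ℂ) :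
    c₀ * ∑ x : Site (F.P K) 0, ‖N x‖ ^ 2 ≤ ‖toL2S F K c₀ N‖ ^ 2 := by
  have hc : 0 < c₀ := Fact.out
  rw [normSq_toL2S_eq]
  exact mul_le_mul_of_nonneg_left (Finset.sum_le_sum fun x _ => MatrixNorms.opNorm_sq_le_sum_norm_sq (N x)) hc.le

/-- `c₀·Σ_b‖(D_{U₀}N)(b)‖²_op ≤ ‖DL2 U₀ (toL2S N)‖²` for the route read-back `D_{U₀}N := toL2⁻¹(DL2 U₀ (toL2S N))`. [cite: Balaban1985BackgroundPropagators, (3.3) p.391, (3.11) p.392] -/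
theorem mul_sum_normSq_le_normSq_DL2 (U₀ : GaugeField (F.P K) 0 (Matrix.specialUnitaryGroup (Fin 2) ℂ)) (N : Site (F.P K) 0 → Matrix (Fin 2) (Fin 2) ℂ) :
    c₀ * ∑ b : PBond (F.P K) 0, ‖(toL2 F K c₀).symm (DL2 F n K c₀ U₀ (toL2S F K c₀ N)) b‖ ^ 2 ≤ ‖DL2 F n K c₀ U₀ (toL2S F K c₀ N)‖ ^ 2 := by
  have hc : 0 < c₀ := Fact.out
  have h := normSq_toL2_eq F (c₀ := c₀) ((toL2 F K c₀).symm (DL2 F n K c₀ U₀ (toL2S F K c₀ N)))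
  rw [LinearEquiv.apply_symm_apply] at h
  rw [h]
  exact mul_le_mul_of_nonneg_left (Finset.sum_le_sum fun b _ => MatrixNorms.opNorm_sq_le_sum_norm_sq _) hc.le

/-! ## §2 (E1) in `L²` -/

/-- ★★ **(E1) IN THE WEIGHTED `L²` NORMS.**  Under clauses 1–2 of (19) for the exponent `A` relative to `U₀` (`‖A(b)‖ ≤ εη`, DIAGONAL covariant gradients `≤ εη²`, `0 ≤ ε`), for every gauge
parameter `N`: `‖D*_{U₀} toL2(b ↦ e^{A(b)}U₀(b)N(b₊)U₀(b)⋆e^{−A(b)} − U₀(b)N(b₊)U₀(b)⋆)‖ ≤ 2e^{εη}e^{εη}·ε·η·(6‖toL2S N‖ + 4‖DL2 U₀ (toL2S N)‖)` — `η`-free up to the displayed factor `η`.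
Proof: ✓`norm_DstarPi_rot_le` pointwise, `‖toL2S f‖² ≤ 2c₀Σ_x‖f x‖²_op`, Cauchy–Schwarz over the directions, operator ≤ Frobenius for the right-hand norms.
[cite: Balaban1985BackgroundPropagators, (3.3) p.391, (3.8) p.392, (3.11) p.392; Balaban1985Variational, (19) p.281] -/
theorem norm_DstarL2_rot_le (U₀ : GaugeField (F.P K) 0 (Matrix.specialUnitaryGroup (Fin 2) ℂ)) (A : PBond (F.P K) 0 → Matrix (Fin 2) (Fin 2) ℂ) {ε : ℝ} (hε : 0 ≤ ε)
    (hA0 : ∀ b, ‖A b‖ ≤ ε * eta F n K) (hA1 : ∀ (μ : Fin 3) (x : Site (F.P K) 0), ‖covGradT 1 (bgUnits F K U₀) A μ μ x‖ ≤ ε * eta F n K ^ 2)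
    (N : Site (F.P K) 0 → Matrix (Fin 2) (Fin 2) ℂ) :
    ‖DstarL2 F n K c₀ U₀ (toL2 F K c₀ (fun b => exp (A b) * (((U₀ b : Matrix.specialUnitaryGroup (Fin 2) ℂ) : Matrix (Fin 2) (Fin 2) ℂ) * N b.tgt *
          star (((U₀ b) : Matrix.specialUnitaryGroup (Fin 2) ℂ) : Matrix (Fin 2) (Fin 2) ℂ)) * exp (-(A b)) -
        ((U₀ b : Matrix.specialUnitaryGroup (Fin 2) ℂ) : Matrix (Fin 2) (Fin 2) ℂ) * N b.tgt * star (((U₀ b) : Matrix.specialUnitaryGroup (Fin 2) ℂ) : Matrix (Fin 2) (Fin 2) ℂ)))‖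
      ≤ 2 * (Real.exp (ε * eta F n K) * Real.exp (ε * eta F n K)) * ε * eta F n K *
          (6 * ‖toL2S F K c₀ N‖ + 4 * ‖DL2 F n K c₀ U₀ (toL2S F K c₀ N)‖) := by
  have hc : 0 < c₀ := Fact.out
  have hη : 0 < eta F n K := eta_pos F n K
  set κ : ℝ := 2 * (Real.exp (ε * eta F n K) * Real.exp (ε * eta F n K)) * ε * eta F n K with hκ
  have hκ0 : 0 ≤ κ := by positivity
  set Y : PBond (F.P K) 0 → Matrix (Fin 2) (Fin 2) ℂ := fun b => exp (A b) * (((U₀ b : Matrix.specialUnitaryGroup (Fin 2) ℂ) : Matrix (Fin 2) (Fin 2) ℂ) * N b.tgt *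
      star (((U₀ b) : Matrix.specialUnitaryGroup (Fin 2) ℂ) : Matrix (Fin 2) (Fin 2) ℂ)) * exp (-(A b)) -
    ((U₀ b : Matrix.specialUnitaryGroup (Fin 2) ℂ) : Matrix (Fin 2) (Fin 2) ℂ) * N b.tgt * star (((U₀ b) : Matrix.specialUnitaryGroup (Fin 2) ℂ) : Matrix (Fin 2) (Fin 2) ℂ) with hY
  set G : PBond (F.P K) 0 → Matrix (Fin 2) (Fin 2) ℂ := (toL2 F K c₀).symm (DL2 F n K c₀ U₀ (toL2S F K c₀ N)) with hG
  set a : ℝ := ‖toL2S F K c₀ N‖ with ha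
  set d : ℝ := ‖DL2 F n K c₀ U₀ (toL2S F K c₀ N)‖ with hd
  -- read `DstarL2 (toL2 Y)` back as `toL2S (DstarPi Y)`
  have hread : DstarL2 F n K c₀ U₀ (toL2 F K c₀ Y) = toL2S F K c₀ (DstarPi F n K c₀ U₀ Y) := by
    rw [DstarPi_apply, LinearEquiv.apply_symm_apply]
  -- the pointwise bound, squared
  have hpt : ∀ x : Site (F.P K) 0, ‖DstarPi F n K c₀ U₀ Y x‖ ^ 2 ≤ κ ^ 2 * (18 * ‖N x‖ ^ 2 + 6 * ∑ μ : Fin 3, ‖G ⟨x, μ⟩‖ ^ 2) := by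
    intro x
    have h1 : ‖DstarPi F n K c₀ U₀ Y x‖ ≤ κ * (3 * ‖N x‖ + ∑ μ : Fin 3, ‖G ⟨x, μ⟩‖) := norm_DstarPi_rot_le F U₀ A hA0 hA1 N x
    have h2 : 0 ≤ 3 * ‖N x‖ + ∑ μ : Fin 3, ‖G ⟨x, μ⟩‖ := by positivity
    calc ‖DstarPi F n K c₀ U₀ Y x‖ ^ 2 ≤ (κ * (3 * ‖N x‖ + ∑ μ : Fin 3, ‖G ⟨x, μ⟩‖)) ^ 2 := pow_le_pow_left₀ (norm_nonneg _) h1 2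
      _ = κ ^ 2 * (3 * ‖N x‖ + ∑ μ : Fin 3, ‖G ⟨x, μ⟩‖) ^ 2 := by ring
      _ ≤ κ ^ 2 * (18 * ‖N x‖ ^ 2 + 6 * ∑ μ : Fin 3, ‖G ⟨x, μ⟩‖ ^ 2) :=
          mul_le_mul_of_nonneg_left (sq_three_mul_add_sum_le _ _) (sq_nonneg _)
  -- sum over the torus
  have hsq : ‖DstarL2 F n K c₀ U₀ (toL2 F K c₀ Y)‖ ^ 2 ≤ κ ^ 2 * (36 * a ^ 2 + 12 * d ^ 2) := by
    rw [hread]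
    calc ‖toL2S F K c₀ (DstarPi F n K c₀ U₀ Y)‖ ^ 2 ≤ 2 * c₀ * ∑ x : Site (F.P K) 0, ‖DstarPi F n K c₀ U₀ Y x‖ ^ 2 := normSq_toL2S_le_two_mul F _
      _ ≤ 2 * c₀ * ∑ x : Site (F.P K) 0, κ ^ 2 * (18 * ‖N x‖ ^ 2 + 6 * ∑ μ : Fin 3, ‖G ⟨x, μ⟩‖ ^ 2) := by
          gcongr with x _
          exact hpt x
      _ = κ ^ 2 * (36 * (c₀ * ∑ x : Site (F.P K) 0, ‖N x‖ ^ 2) + 12 * (c₀ * ∑ x : Site (F.P K) 0, ∑ μ : Fin 3, ‖G ⟨x, μ⟩‖ ^ 2)) := by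
          have hS : ∑ x : Site (F.P K) 0, κ ^ 2 * (18 * ‖N x‖ ^ 2 + 6 * ∑ μ : Fin 3, ‖G ⟨x, μ⟩‖ ^ 2)
              = κ ^ 2 * (18 * ∑ x : Site (F.P K) 0, ‖N x‖ ^ 2 + 6 * ∑ x : Site (F.P K) 0, ∑ μ : Fin 3, ‖G ⟨x, μ⟩‖ ^ 2) := by
            rw [mul_add, Finset.mul_sum, Finset.mul_sum, Finset.mul_sum, Finset.mul_sum, ← Finset.sum_add_distrib]
            refine Finset.sum_congr rfl fun x _ => ?_
            ring
          rw [hS]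
          ring
      _ ≤ κ ^ 2 * (36 * a ^ 2 + 12 * d ^ 2) := by
          have h1 := mul_sum_normSq_le_normSq_toL2S F (c₀ := c₀) N
          have h2 : c₀ * ∑ x : Site (F.P K) 0, ∑ μ : Fin 3, ‖G ⟨x, μ⟩‖ ^ 2 ≤ d ^ 2 := by
            rw [sum_site_dir_eq_sum_bond F (fun b => ‖G b‖ ^ 2)]
            exact mul_sum_normSq_le_normSq_DL2 F U₀ N
          gcongr
  -- extract the square root
  have hrhs : κ ^ 2 * (36 * a ^ 2 + 12 * d ^ 2) ≤ (κ * (6 * a + 4 * d)) ^ 2 := by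
    have ha0 : 0 ≤ a := norm_nonneg _
    have hd0 : 0 ≤ d := norm_nonneg _
    nlinarith [mul_nonneg ha0 hd0, sq_nonneg κ, mul_nonneg (sq_nonneg κ) (mul_nonneg ha0 hd0), mul_nonneg (sq_nonneg κ) (sq_nonneg d)]
  have hfin : ‖DstarL2 F n K c₀ U₀ (toL2 F K c₀ Y)‖ ^ 2 ≤ (κ * (6 * a + 4 * d)) ^ 2 := hsq.trans hrhs
  have hnn : 0 ≤ κ * (6 * a + 4 * d) := by positivity
  exact (pow_le_pow_iff_left₀ (norm_nonneg _) hnn two_ne_zero).1 hfin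

end Summit.QuantumFields.YangMills.Theorems.Prop7GaugeDirRotationDivergence

end
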